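import Summits.Ventures.HodgeRepro2.T5SU11JacobiDuplication
import Summits.Ventures.HodgeRepro2.T5SU11JacobiWeight

/-!
# The two-step recursion of the Jacobi transform in the weight: `m̂_{k+2}(λ) = (1 − 2/k − λ(λ−2)/k²) m̂_k(λ)`

From the symmetric closed form `m̂_k(λ) = π Γ((k−λ)/2) Γ((k+λ)/2 − 1)/Γ(k/2)²` (`T5SU11JacobiDuplication`)
and `Γ(s + 1) = s Γ(s)`, the transform satisfies the **two-step recursion in the weight**

  **`m̂_{k+2}(λ) = ((k − λ)(k + λ − 2)/k²) · m̂_k(λ)`**,   `(k − λ)(k + λ − 2)/k² = 1 − 2/k − λ(λ − 2)/k²`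

(`jacobi_weight_add_two`, `weightRatio_eq`) — the weight-`2` step is governed by the Casimir eigenvalue
`λ(λ − 2)` of the radial equation (`T5SU11SphericalODE`) — and, iterated, the product formula
`m̂_{k+2n}(λ) = m̂_k(λ) ∏_{i<n} (k+2i−λ)(k+2i+λ−2)/(k+2i)²` (`jacobi_weight_add_two_mul`). The ratio lies in
`(0, 1)` (`weightRatio_pos`, `weightRatio_lt_one`: the strict antitonicity of `T5SU11JacobiWeight` read in
closed form) and is **strictly increasing in the weight** (`weightRatio_lt_weightRatio`:
`r(k₂) − r(k₁) = (k₂ − k₁)(2k₁k₂ − λ(2−λ)(k₁+k₂))/(k₁k₂)²` with `λ(2 − λ) ≤ 1 < 2k₁k₂/(k₁+k₂)`), the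
closed-form instance of the monotone decay ratio of `T5SU11JacobiCompleteMonotonePhase.jacobi_ratio_le`
at `h = 2`. Nothing is claimed about (N).

Blind lane: Mathlib + the HodgeRepro2 prefix only; no sorry; axioms ⊆ {propext, Classical.choice,
Quot.sound}.
-/

namespace Summit.Ventures.HodgeRepro2.T5SU11JacobiWeightRecursion

open MeasureTheory MeasureTheory.Measure Metric Set Filter Topology Finset
open T5SU11Unimodular T5SU11Fibration T5SU11Cartan T5HaarCircle T5BergmanCoefficient
  T5SU11FibrationHaar T5SU11SphericalFunction T5SU11SphericalSymmetry T5SU11SphericalBounds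
  T5SU11SphericalContinuous T5SU11JacobiIwasawa T5SU11JacobiTransform T5SU11JacobiWeight
  T5SU11KFiniteMajorantPow T5SU11JacobiDuplication
open scoped Real

/-! ### The ratio `r_k(λ) = (k − λ)(k + λ − 2)/k²` -/

/-- The weight-`2` ratio `r_k(λ) := (k − λ)(k + λ − 2)/k²`. -/
noncomputable def weightRatio (k lam : ℝ) : ℝ := (k - lam) * (k + lam - 2) / k ^ 2

/-- `r_k(λ) = 1 − 2/k − λ(λ − 2)/k²`: the weight-`2` step is governed by the Casimir eigenvalue `λ(λ − 2)`. -/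
theorem weightRatio_eq {k : ℝ} (hk : k ≠ 0) (lam : ℝ) :
    weightRatio k lam = 1 - 2 / k - lam * (lam - 2) / k ^ 2 := by
  unfold weightRatio
  field_simp
  ring

/-- `r_k(λ) > 0` on the ray (`λ < k`, `k + λ > 2`). -/
theorem weightRatio_pos {k lam : ℝ} (h1 : lam < k) (h2 : 2 < k + lam) : 0 < weightRatio k lam := by
  unfold weightRatio
  have hk : 0 < k := by linarith
  exact div_pos (mul_pos (by linarith) (by linarith)) (by positivity)

/-- `r_k(λ) < 1` on the ray: `(k − λ)(k + λ − 2) = k² − 2k + λ(2 − λ) < k²` since `λ(2 − λ) ≤ 1 < 2k`. -/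
theorem weightRatio_lt_one {k lam : ℝ} (hk : 1 < k) : weightRatio k lam < 1 := by
  unfold weightRatio
  have hk0 : 0 < k ^ 2 := by positivity
  rw [div_lt_one hk0]
  nlinarith [sq_nonneg (lam - 1)]

/-- **The ratio is strictly increasing in the weight**: `k₁ < k₂` on the ray `k > 1` ⇒ `r_{k₁}(λ) < r_{k₂}(λ)`
(`r(k₂) − r(k₁) = (k₂ − k₁)(2k₁k₂ − λ(2−λ)(k₁+k₂))/(k₁k₂)²` and `λ(2−λ) ≤ 1`, `2k₁k₂ > k₁ + k₂`). -/
theorem weightRatio_lt_weightRatio {k₁ k₂ lam : ℝ} (hk₁ : 1 < k₁) (hk : k₁ < k₂) :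
    weightRatio k₁ lam < weightRatio k₂ lam := by
  have hk₂ : 1 < k₂ := hk₁.trans hk
  rw [weightRatio_eq (by linarith), weightRatio_eq (by linarith), ← sub_pos]
  have e : 1 - 2 / k₂ - lam * (lam - 2) / k₂ ^ 2 - (1 - 2 / k₁ - lam * (lam - 2) / k₁ ^ 2)
      = (k₂ - k₁) * (2 * k₁ * k₂ - lam * (2 - lam) * (k₁ + k₂)) / (k₁ ^ 2 * k₂ ^ 2) := by
    field_simp
    ring
  rw [e]
  refine div_pos (mul_pos (by linarith) (sub_pos.mpr ?_)) (by positivity)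
  have h1 : lam * (2 - lam) ≤ 1 := by nlinarith [sq_nonneg (lam - 1)]
  have h2 : k₁ + k₂ < 2 * k₁ * k₂ := by nlinarith
  have h3 : 0 < k₁ + k₂ := by linarith
  calc lam * (2 - lam) * (k₁ + k₂) ≤ 1 * (k₁ + k₂) := by gcongr
    _ < 2 * k₁ * k₂ := by linarith

/-- Monotone (non-strict) form on the ray. -/
theorem weightRatio_le_weightRatio {k₁ k₂ lam : ℝ} (hk₁ : 1 < k₁) (hk : k₁ ≤ k₂) :
    weightRatio k₁ lam ≤ weightRatio k₂ lam := by
  rcases hk.lt_or_eq with h | rfl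
  · exact (weightRatio_lt_weightRatio hk₁ h).le
  · exact le_rfl

/-! ### The recursion -/

section measure

variable [MeasurableSpace Circle] [BorelSpace Circle]

/-- **THE TWO-STEP RECURSION IN THE WEIGHT**: for `k > 1`, `λ < k`, `k + λ > 2`,
`m̂_{k+2}(λ) = ((k − λ)(k + λ − 2)/k²) · m̂_k(λ)` (`Γ(s + 1) = s Γ(s)` in each of the three Gamma factors of
the symmetric closed form). -/
theorem jacobi_weight_add_two {k lam : ℝ} (hk : 1 < k) (h1 : lam < k) (h2 : 2 < k + lam) :
    ∫ g, (1 - ‖orbit g‖ ^ 2) ^ ((k + 2) / 2) * sph lam g ∂(nu haarCircle)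
      = weightRatio k lam * ∫ g, (1 - ‖orbit g‖ ^ 2) ^ (k / 2) * sph lam g ∂(nu haarCircle) := by
  rw [integral_orbit_rpow_mul_sph_dup (by linarith) (by linarith) (by linarith),
    integral_orbit_rpow_mul_sph_dup hk h1 h2,
    show (k + 2 - lam) / 2 = (k - lam) / 2 + 1 by ring,
    show (k + 2 + lam) / 2 - 1 = ((k + lam) / 2 - 1) + 1 by ring,
    show (k + 2) / 2 = k / 2 + 1 by ring,
    Real.Gamma_add_one (by intro h; linarith : (k - lam) / 2 ≠ 0),
    Real.Gamma_add_one (by intro h; linarith : (k + lam) / 2 - 1 ≠ 0),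
    Real.Gamma_add_one (by intro h; linarith : k / 2 ≠ 0)]
  have g : 0 < Real.Gamma (k / 2) := Real.Gamma_pos_of_pos (by linarith)
  have hk0 : k ≠ 0 := by linarith
  unfold weightRatio
  field_simp

/-- The recursion solved for `m̂_k(λ)`: `m̂_k(λ) = m̂_{k+2}(λ) / r_k(λ)`. -/
theorem jacobi_weight_eq_add_two_div {k lam : ℝ} (hk : 1 < k) (h1 : lam < k) (h2 : 2 < k + lam) :
    ∫ g, (1 - ‖orbit g‖ ^ 2) ^ (k / 2) * sph lam g ∂(nu haarCircle)
      = (∫ g, (1 - ‖orbit g‖ ^ 2) ^ ((k + 2) / 2) * sph lam g ∂(nu haarCircle)) / weightRatio k lam := by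
  rw [jacobi_weight_add_two hk h1 h2, mul_div_cancel_left₀ _ (weightRatio_pos h1 h2).ne']

/-- The decay ratio at `h = 2` in closed form: `m̂_{k+2}(λ)/m̂_k(λ) = r_k(λ)`. -/
theorem jacobi_weight_add_two_div {k lam : ℝ} (hk : 1 < k) (h1 : lam < k) (h2 : 2 < k + lam) :
    (∫ g, (1 - ‖orbit g‖ ^ 2) ^ ((k + 2) / 2) * sph lam g ∂(nu haarCircle))
        / ∫ g, (1 - ‖orbit g‖ ^ 2) ^ (k / 2) * sph lam g ∂(nu haarCircle) = weightRatio k lam := by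
  rw [jacobi_weight_add_two hk h1 h2, mul_div_cancel_right₀ _ (jacobi_pos hk h1 h2).ne']

/-- **The product formula**: `m̂_{k+2n}(λ) = m̂_k(λ) · ∏_{i<n} r_{k+2i}(λ)` on the ray. -/
theorem jacobi_weight_add_two_mul {k lam : ℝ} (hk : 1 < k) (h1 : lam < k) (h2 : 2 < k + lam) (n : ℕ) :
    ∫ g, (1 - ‖orbit g‖ ^ 2) ^ ((k + 2 * n) / 2) * sph lam g ∂(nu haarCircle)
      = (∏ i ∈ range n, weightRatio (k + 2 * i) lam)
        * ∫ g, (1 - ‖orbit g‖ ^ 2) ^ (k / 2) * sph lam g ∂(nu haarCircle) := by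
  induction n with
  | zero => simp
  | succ n ih =>
    have hn : (0 : ℝ) ≤ 2 * n := by positivity
    rw [show (k + 2 * ((n + 1 : ℕ) : ℝ)) / 2 = (k + 2 * n + 2) / 2 by push_cast; ring,
      jacobi_weight_add_two (by linarith) (by linarith) (by linarith), ih, Finset.prod_range_succ]
    ring

/-- The strict antitonicity at step `2` read in closed form: `m̂_{k+2}(λ) < m̂_k(λ)`. -/
theorem jacobi_weight_add_two_lt {k lam : ℝ} (hk : 1 < k) (h1 : lam < k) (h2 : 2 < k + lam) :
    ∫ g, (1 - ‖orbit g‖ ^ 2) ^ ((k + 2) / 2) * sph lam g ∂(nu haarCircle)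
      < ∫ g, (1 - ‖orbit g‖ ^ 2) ^ (k / 2) * sph lam g ∂(nu haarCircle) := by
  rw [jacobi_weight_add_two hk h1 h2]
  exact mul_lt_of_lt_one_left (jacobi_pos hk h1 h2) (weightRatio_lt_one hk)

/-- The monotone decay ratio at `h = 2` in closed form: `k₁ ≤ k₂` on the ray ⇒
`m̂_{k₁+2}(λ)/m̂_{k₁}(λ) ≤ m̂_{k₂+2}(λ)/m̂_{k₂}(λ)`. -/
theorem jacobi_ratio_two_le {k₁ k₂ lam : ℝ} (hk₁ : 1 < k₁) (h11 : lam < k₁) (h12 : 2 < k₁ + lam)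
    (hk : k₁ ≤ k₂) :
    (∫ g, (1 - ‖orbit g‖ ^ 2) ^ ((k₁ + 2) / 2) * sph lam g ∂(nu haarCircle))
        / ∫ g, (1 - ‖orbit g‖ ^ 2) ^ (k₁ / 2) * sph lam g ∂(nu haarCircle)
      ≤ (∫ g, (1 - ‖orbit g‖ ^ 2) ^ ((k₂ + 2) / 2) * sph lam g ∂(nu haarCircle))
        / ∫ g, (1 - ‖orbit g‖ ^ 2) ^ (k₂ / 2) * sph lam g ∂(nu haarCircle) := by
  rw [jacobi_weight_add_two_div hk₁ h11 h12,
    jacobi_weight_add_two_div (by linarith) (by linarith) (by linarith)]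
  exact weightRatio_le_weightRatio hk₁ hk

end measure

end Summit.Ventures.HodgeRepro2.T5SU11JacobiWeightRecursion
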